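import Summits.FinalStateConjecture.FinalStateConjecture.Theses.ZeroEnergyKerrOrBomb
import Literature.Geometry.Lorentzian.DocStationarySpacetime
import Literature.Geometry.Lorentzian.CauchyDevelopmentRestrict
import Literature.Geometry.Lorentzian.EinsteinTensorNaturality
import Literature.Geometry.Lorentzian.ConnectionNaturality
import Literature.Geometry.Lorentzian.OpensCausality
import Literature.Geometry.Manifold.OpenSubmanifoldTangent
import Literature.Geometry.Manifold.OpenSubmanifoldMFDeriv

/-!
# `ZeroEnergyRigidity`, line `global-horizon-killing-field` — stub `stub_futurePresentation`,
# part B: vector fields, Killing fields and the connection read on an open sub-carrier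

Support file for crux `stmt-FinalStateConjecture-10690`
(`Summit.FinalStateConjecture.FinalStateConjecture.Theses.ZeroEnergyKerrOrBomb.ZeroEnergyRigidity`),
stub S1b `stub_futurePresentation` (WLOG the carrier of a presentation is `I⁺(M_ext)`):

* orbits read on an open submanifold `U` (`image_val_stationaryOrbit`; integral curves and
  pulled-back fields of `U` are those of `M`, `isMIntegralCurve_subtypeVal_comp_iff` and
  `mpullback_subtypeVal` of `DocStationarySpacetime`: `dι = id`, `T_y U = T_y M`);
* a Killing field of a presentation `𝓑` read on an open sub-carrier `U` is a Killing field of the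
  restricted metric `g|_U` (`isKillingField_restrict`: `g|_U = ι^* g` is the pullback along the
  inclusion, `restrict_eq_comap`, and Killing fields pull back, `IsKillingField.comap_mpullback`),
  the connection restricts (`leviCivita_restrict_apply`, naturality of the Levi-Civita connection),
  and the inclusion is a smooth isometric immersion (`isIsometricImmersion_val`).

References: B. O'Neill, *Semi-Riemannian geometry* (1983), Ch. 1, p. 7, Ch. 3, p. 57 and
Prop. 3.59, Ch. 9, Prop. 9.25; J. M. Lee, *Introduction to Smooth Manifolds* (2013), Prop. 3.9
and Ch. 9; P. T. Chruściel, J. L. Costa, Astérisque 321 (2008), §2.2 ((2.1)).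
-/

noncomputable section

-- `Summit.FinalStateConjecture.FinalStateConjecture.…`: summit = problem name (D-0017).
set_option linter.dupNamespace false

namespace Summit.FinalStateConjecture.FinalStateConjecture.Theorems.ZeroEnergyRigidity.GlobalHorizonKillingField.FuturePresentation

open Set Function Filter TopologicalSpace Bundle Literature.Geometry.Lorentzian
open LorentzianMetric (isFutureTimelikeCurveOn_restrict_iff)
open scoped Manifold ContDiff Topology

/-! ## Integral curves, vector fields and Killing fields read on an open submanifold -/

section OpenSubmanifold

variable {E : Type*} [NormedAddCommGroup E] [NormedSpace ℝ E] {H : Type*} [TopologicalSpace H]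
  {I : ModelWithCorners ℝ E H} {M : Type*} [TopologicalSpace M] [ChartedSpace H M]

/-- **The orbit of a set under a field restricted to an invariant open submanifold**: if every
integral curve of `V` starting in `U` stays in `U`, then for `A ⊆ U` the orbit of `A` under `V|U`,
read in `M`, is the orbit of `ι A` under `V`. Chruściel–Costa 2008, (2.1). [folklore] -/
theorem image_val_stationaryOrbit (U : Opens M) {V : Π x : M, TangentSpace I x}
    (hU : ∀ γ : ℝ → M, IsMIntegralCurve γ V → γ 0 ∈ U → ∀ t, γ t ∈ U) (A : Set U) :
    Subtype.val '' stationaryOrbit (I := I) (fun y : U ↦ (V y.1 : TangentSpace I y)) A =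
      stationaryOrbit V (Subtype.val '' A) := by
  refine Subset.antisymm ?_ ?_
  · rintro _ ⟨_, ⟨γ, hγ, h0, t, rfl⟩, rfl⟩
    exact ⟨Subtype.val ∘ γ, (isMIntegralCurve_subtypeVal_comp_iff U).2 hγ, mem_image_of_mem _ h0,
      t, rfl⟩
  · rintro _ ⟨γ, hγ, ⟨a, ha, hγ0⟩, t, rfl⟩
    have hmem : ∀ s, γ s ∈ U := hU γ hγ (hγ0 ▸ a.2)
    have h0 : (⟨γ 0, hmem 0⟩ : U) = a := Subtype.ext hγ0.symm
    exact ⟨⟨γ t, hmem t⟩, ⟨fun s ↦ ⟨γ s, hmem s⟩, isMIntegralCurve_codRestrict U hγ hmem,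
      (by rw [show (fun s ↦ (⟨γ s, hmem s⟩ : U)) 0 = a from h0]; exact ha), t, rfl⟩, rfl⟩

variable [IsManifold I ∞ M] {n : ℕ∞ω}

/-- Equal metrics have equal Levi-Civita connections (whatever the proofs of the standing
Levi-Civita hypothesis). [folklore] -/
theorem leviCivita_congr_metric
    {g₁ g₂ : PseudoRiemannianMetric I n E (TangentSpace I : M → Type _)} (h : g₁ = g₂)
    (i₁ : g₁.HasLeviCivita) (i₂ : g₂.HasLeviCivita) (X : Π x : M, TangentSpace I x) (x : M) :
    g₁.leviCivita X x = g₂.leviCivita X x := by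
  subst h; rfl

end OpenSubmanifold

/-! ## Killing fields of a presentation read on an open sub-carrier -/

section SubKilling

variable (𝓑 : StationaryAFBlackHole.{0}) [𝓑.metric.HasLeviCivita] (U : Opens 𝓑.carrier)
  [(𝓑.metric.restrict PseudoRiemannianMetric.contMDiff_restrict_holds U).HasLeviCivita]

/-- **A Killing field of `g` read on the open sub-carrier `U` is a Killing field of `g|_U`.** The
restricted metric is the pullback `ι^* g` along the inclusion (`restrict_eq_comap`), `K|U = ι^* K`
(`mpullback_subtypeVal`), and Killing fields pull back to Killing fields under local isometries
(`IsKillingField.comap_mpullback`). O'Neill 1983, Ch. 9, Prop. 9.25 with Ch. 3, p. 57. [folklore] -/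
theorem isKillingField_restrict {K : Π x : 𝓑.carrier, TangentSpace (𝓡 4) x}
    (hK : 𝓑.metric.IsKillingField K) :
    (𝓑.metric.restrict PseudoRiemannianMetric.contMDiff_restrict_holds U).IsKillingField
      (fun y : U ↦ (K y.1 : TangentSpace (𝓡 4) y)) := by
  set gc := 𝓑.metric.toPseudoRiemannianMetric.comap
    PseudoRiemannianMetric.contMDiff_pullbackBilin_holds
    (Subtype.val : U → 𝓑.carrier) contMDiff_subtype_val
    (injective_mfderiv_subtypeVal U) rfl with hgc_def
  haveI hgcLC : gc.HasLeviCivita := gc.hasLeviCivita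
  have hgc : (𝓑.metric.restrict PseudoRiemannianMetric.contMDiff_restrict_holds
      U).toPseudoRiemannianMetric = gc :=
    PseudoRiemannianMetric.restrict_eq_comap 𝓑.metric.toPseudoRiemannianMetric U
  have key : gc.IsKillingField
      (VectorField.mpullback (𝓡 4) (𝓡 4) (Subtype.val : U → 𝓑.carrier) K) :=
    PseudoRiemannianMetric.IsKillingField.comap_mpullback 𝓑.metric.toPseudoRiemannianMetric
      PseudoRiemannianMetric.contMDiff_pullbackBilin_holds contMDiff_subtype_val
      (injective_mfderiv_subtypeVal U) rfl hK
  rw [mpullback_subtypeVal] at key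
  exact (PseudoRiemannianMetric.isKillingField_congr_metric hgc inferInstance hgcLC _).2 key

/-- **The connection restricts: `∇^{g|}_v (K|) (y) = ∇^g_v K (↑y)`** for a smooth vector field `K`
(naturality of the Levi-Civita connection under the inclusion, `leviCivita_comap_mpullback_apply`,
`dι = id`). O'Neill 1983, Ch. 3, Prop. 3.59 and p. 57. [folklore] -/
theorem leviCivita_restrict_apply {K : Π x : 𝓑.carrier, TangentSpace (𝓡 4) x}
    (hK : ContMDiff (𝓡 4) (𝓡 4).tangent ∞
      (fun x ↦ (TotalSpace.mk' E4 x (K x) : TangentBundle (𝓡 4) 𝓑.carrier)))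
    (y : U) (v : TangentSpace (𝓡 4) y) :
    (𝓑.metric.restrict PseudoRiemannianMetric.contMDiff_restrict_holds
        U).toPseudoRiemannianMetric.leviCivita (fun y : U ↦ (K y.1 : TangentSpace (𝓡 4) y)) y v =
      𝓑.metric.toPseudoRiemannianMetric.leviCivita K y.1 v := by
  set gc := 𝓑.metric.toPseudoRiemannianMetric.comap
    PseudoRiemannianMetric.contMDiff_pullbackBilin_holds
    (Subtype.val : U → 𝓑.carrier) contMDiff_subtype_val
    (injective_mfderiv_subtypeVal U) rfl with hgc_def
  haveI hgcLC : gc.HasLeviCivita := gc.hasLeviCivita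
  have hgc : (𝓑.metric.restrict PseudoRiemannianMetric.contMDiff_restrict_holds
      U).toPseudoRiemannianMetric = gc :=
    PseudoRiemannianMetric.restrict_eq_comap 𝓑.metric.toPseudoRiemannianMetric U
  have hY : MDifferentiableAt (𝓡 4) (𝓡 4).tangent
      (fun x ↦ (TotalSpace.mk' E4 x (K x) : TangentBundle (𝓡 4) 𝓑.carrier))
      ((Subtype.val : U → 𝓑.carrier) y) :=
    (hK y.1).mdifferentiableAt (by simp)
  rw [leviCivita_congr_metric hgc inferInstance hgcLC, ← mpullback_subtypeVal U K,
    𝓑.metric.toPseudoRiemannianMetric.leviCivita_comap_mpullback_apply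
      PseudoRiemannianMetric.contMDiff_pullbackBilin_holds contMDiff_subtype_val
      (injective_mfderiv_subtypeVal U) rfl hY v,
    inverse_mfderiv_subtypeVal_apply, mfderiv_subtypeVal_apply]

omit [𝓑.metric.HasLeviCivita]
  [(𝓑.metric.restrict PseudoRiemannianMetric.contMDiff_restrict_holds U).HasLeviCivita] in
/-- The inclusion of an open sub-carrier (restricted metric) is a smooth isometric immersion: its
differential is the identity and `(g|_U)_y = g_y`. O'Neill 1983, Ch. 3, p. 57. [folklore] -/
theorem isIsometricImmersion_val :
    PseudoRiemannianMetric.IsIsometricImmersion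
      (𝓑.metric.restrict PseudoRiemannianMetric.contMDiff_restrict_holds U).toPseudoRiemannianMetric
      𝓑.metric.toPseudoRiemannianMetric (Subtype.val : U → 𝓑.carrier) := by
  refine ⟨contMDiff_subtype_val, fun x ↦ ?_⟩
  ext v w
  rw [pullbackBilin_apply, Literature.Geometry.Manifold.OpenSubmanifold.mfderiv_subtype_val]
  rfl

/-- **Registered sub-goal `stub_futurePresentation_killingRestrict`** (helper of stub S1b
`stub_futurePresentation`, crux `stmt-FinalStateConjecture-10690`): a Killing field of a
presentation read on an open sub-carrier is a Killing field of the restricted metric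
(`isKillingField_restrict`). O'Neill 1983, Ch. 9, Prop. 9.25 with Ch. 3, p. 57. [folklore] -/
theorem stub_futurePresentation_killingRestrict :
    ∀ (𝓑 : StationaryAFBlackHole.{0}) [𝓑.metric.HasLeviCivita] (U : TopologicalSpace.Opens 𝓑.carrier)
      [(𝓑.metric.restrict PseudoRiemannianMetric.contMDiff_restrict_holds U).HasLeviCivita]
      (K : Π x : 𝓑.carrier, TangentSpace (𝓡 4) x), 𝓑.metric.IsKillingField K →
        (𝓑.metric.restrict PseudoRiemannianMetric.contMDiff_restrict_holds U).IsKillingField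
          (fun y : U ↦ (K y.1 : TangentSpace (𝓡 4) y)) :=
  fun 𝓑 _ U _ _ hK ↦ isKillingField_restrict 𝓑 U hK

end SubKilling

end Summit.FinalStateConjecture.FinalStateConjecture.Theorems.ZeroEnergyRigidity.GlobalHorizonKillingField.FuturePresentation

end
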